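import Summits.CriticalPhenomena.PercolationContinuityZ3.Theorems.Transplant.FKConnectivityAllQPat3ShapeOneKCone
import Summits.CriticalPhenomena.PercolationContinuityZ3.Theorems.Transplant.FKConnectivityAllQPat3ShapeZero
import HarnessLib

/-!
# Connectivity correlation inequalities for `φ_{w,q}`, every `q > 0` — PIECE-FREE SHAPES WITH CONTRACTED SKELETON EDGES (`t = 0`)
# and the SPLITS of a skeleton into free / contracted edges (census g41)

Definitions + theorems file (`--supports stmt-CriticalPhenomena-4575`), census lineage (gen 41) of LANE 2's FK sub-programme; builds on
p205010 (kernel theorem, internal audit signed; external expert review pending).  No named facts, no sorries; standard axioms.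

Census g41 (memo HOME/FROM-census-g41-*.md): in the MINOR form `(E, C)` of THEOREM 𝒯₂(𝒦) / THEOREM SP(W₄-free) every `K₄`-skeleton
leaf occurs in all `{free, contracted}` states of its plain slots (a contracted plain slot is NOT a minor of a smaller 𝒦-network on
the same vertex type).  This file is the `t = 0` engine for those states (the bridge row B0: the explicit graph `K₄ − ab` with free
edges `L` and contracted edges `K`, inner mark at `c`), sibling of census g40's `…Pat3ShapeZero` (`K = []`):
* `FK.shape0ValK L K ix iy is F d`, `FK.lev2C_shape0K` (`lev2C (plainSet p L) (plainSet p K) x y s F μ` = `shape0ValK` at the residual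
  level `μ + |L| + 2|K| − 2|V|`, by `FK.sum_plainListK_empty`), `FK.shape0ValK_eq_zero`, **`FK.baseCheck0K`** (`Bool`) and
  **`FK.shape0K_nonneg_of_check`** (a passed check ⇒ `F ≥ 0` levelwise on the explicit minor);
* **`FK.splits S`** — the `2^{|S|}` ordered splits `(L, K)` of a list (free part, contracted part), with `FK.splits_sublist`,
  `FK.splits_length`, `FK.splits_subset` and **`FK.filter_mem_splits`** (the split read off a minor `(E, C)` by membership is one of
  them), `FK.splits_forall`, `FK.splits_nodup_left`, `FK.plainSet_subset_of_splits` — the indexing of the state data files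
  `…Pat3BridgeB0KDataC/D`, `…Pat3BridgeKDataB1/B2`, `…Pat3VeeK…` and of the K-state leaf lemmas.
[cite: AyyerLinussonRavichandran2025, §7 (p. 22)] [cite: Grimmett2006, §1.4 eq. (1.20) (p. 15)]
-/

namespace Summit.CriticalPhenomena.PercolationContinuityZ3.Theorems

namespace FK

open SimpleGraph Literature.Probability.LatticeModels Literature.Probability.Percolation
open scoped Classical

variable {V : Type*}

/-! ### Splits of a list into a free and a contracted part -/

section Splits

variable {α : Type*}

/-- **All ordered splits of a list** into a first ("free") and a second ("contracted") sublist, both in the list's order: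
`splits [e₁, …, eₙ]` has `2ⁿ` members. [folklore] -/
def splits : List α → List (List α × List α)
  | [] => [([], [])]
  | e :: S => (splits S).map (fun LK => (e :: LK.1, LK.2)) ++ (splits S).map (fun LK => (LK.1, e :: LK.2))

/-- Both parts of a split are sublists. [folklore] -/
theorem splits_sublist {S L K : List α} (h : (L, K) ∈ splits S) : L.Sublist S ∧ K.Sublist S := by
  induction S generalizing L K with
  | nil =>
    simp only [splits, List.mem_singleton, Prod.mk.injEq] at h
    rw [h.1, h.2]; exact ⟨List.Sublist.slnil, List.Sublist.slnil⟩
  | cons e S ih =>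
    simp only [splits, List.mem_append, List.mem_map, Prod.mk.injEq, Prod.exists] at h
    rcases h with ⟨L', K', hm, hL, hK⟩ | ⟨L', K', hm, hL, hK⟩
    · subst hL; subst hK
      exact ⟨(ih hm).1.cons_cons e, (ih hm).2.cons e⟩
    · subst hL; subst hK
      exact ⟨(ih hm).1.cons e, (ih hm).2.cons_cons e⟩

/-- The parts of a split have complementary lengths. [folklore] -/
theorem splits_length {S L K : List α} (h : (L, K) ∈ splits S) : L.length + K.length = S.length := by
  induction S generalizing L K with
  | nil =>
    simp only [splits, List.mem_singleton, Prod.mk.injEq] at h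
    rw [h.1, h.2]; rfl
  | cons e S ih =>
    simp only [splits, List.mem_append, List.mem_map, Prod.mk.injEq, Prod.exists] at h
    rcases h with ⟨L', K', hm, hL, hK⟩ | ⟨L', K', hm, hL, hK⟩
    · subst hL; subst hK
      simp only [List.length_cons]; have := ih hm; omega
    · subst hL; subst hK
      simp only [List.length_cons]; have := ih hm; omega

/-- Members of the parts of a split are members of the list. [folklore] -/
theorem splits_subset {S L K : List α} (h : (L, K) ∈ splits S) : (∀ e ∈ L, e ∈ S) ∧ (∀ e ∈ K, e ∈ S) :=
  ⟨fun _ he => (splits_sublist h).1.subset he, fun _ he => (splits_sublist h).2.subset he⟩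

/-- **The split read off by complementary Boolean tests is a split**: filtering a list by `f` and by `g = ¬f` gives a member of
`splits`. (The state of the plain slots of a leaf in a minor `(E, C)`: `f` = «in `E`», `g` = «in `C`».) [folklore] -/
theorem filter_mem_splits (S : List α) (f g : α → Bool) (hfg : ∀ e ∈ S, g e = !f e) :
    (S.filter f, S.filter g) ∈ splits S := by
  induction S with
  | nil => simp [splits]
  | cons e S ih =>
    have ih' := ih fun x hx => hfg x (List.mem_cons_of_mem e hx)
    have he := hfg e List.mem_cons_self
    simp only [splits, List.mem_append, List.mem_map, Prod.mk.injEq, Prod.exists]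
    cases hf : f e
    · rw [hf] at he
      refine Or.inr ⟨S.filter f, S.filter g, ih', ?_, ?_⟩
      · rw [List.filter_cons_of_neg (by rw [hf]; exact Bool.false_ne_true)]
      · rw [List.filter_cons_of_pos (by rw [he]; rfl)]
    · rw [hf] at he
      refine Or.inl ⟨S.filter f, S.filter g, ih', ?_, ?_⟩
      · rw [List.filter_cons_of_pos (by rw [hf])]
      · rw [List.filter_cons_of_neg (by rw [he]; exact Bool.false_ne_true)]

end Splits

/-! ### Split facts used by the K-state leaf lemmas -/

section SplitFacts

variable {ι : Type*} {p : ι → V} {S L K : List (ι × ι)}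

/-- A property of all skeleton edges holds on both parts of a split. [folklore] -/
theorem splits_forall {P : ι × ι → Prop} (h : (L, K) ∈ splits S) (hS : ∀ e ∈ S, P e) : (∀ e ∈ L, P e) ∧ (∀ e ∈ K, P e) :=
  ⟨fun e he => hS e ((splits_subset h).1 e he), fun e he => hS e ((splits_subset h).2 e he)⟩

/-- The named edges of the free part of a split are distinct if those of the whole skeleton are. [folklore] -/
theorem splits_nodup_left (h : (L, K) ∈ splits S) (hS : (S.map (pedge p)).Nodup) : (L.map (pedge p)).Nodup :=
  hS.sublist ((splits_sublist h).1.map _)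

/-- The edge set of the free part of a split lies in the edge set of the skeleton. [folklore] -/
theorem plainSet_subset_of_splits (h : (L, K) ∈ splits S) : plainSet p L ⊆ plainSet p S := by
  intro e he
  unfold plainSet at he ⊢
  rw [List.mem_toFinset] at he ⊢
  exact ((splits_sublist h).1.map _).subset he

end SplitFacts

/-! ### Piece-free shapes with contracted skeleton edges (t = 0) -/

section ShapeZeroK

variable [Fintype V] {ι : Type*} [DecidableEq ι]

/-- **The value of a piece-free shape with contracted skeleton edges** (explicit graph on injective names: free edges `L`, contracted
edges `K`) at residual level `d` (= level `+ |L| + 2|K| − 2|V|`): the table read on the `K`-folds of the `L`-folds of the identity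
matrix over all colourings with `d` corrections. Computable. [folklore] -/
def shape0ValK (L K : List (ι × ι)) (ix iy is : ι) (F : ℕ → Pat3 → Pat3 → ℤ) (d : ℕ) : ℤ :=
  sumBits L.length fun bs =>
    (if (foldBits (idMat ι) (zipBits L bs)).2 + (foldBits (idMat ι) (zipBits L (bs.map (! ·)))).2 +
          ((foldBits (foldBits (idMat ι) (zipBits L bs)).1 (trueBits K)).2 +
            (foldBits (foldBits (idMat ι) (zipBits L (bs.map (! ·)))).1 (trueBits K)).2) = d then
        F 0 (rdPat ix iy is (foldBits (foldBits (idMat ι) (zipBits L bs)).1 (trueBits K)).1)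
          (rdPat ix iy is (foldBits (foldBits (idMat ι) (zipBits L (bs.map (! ·)))).1 (trueBits K)).1)
      else 0) +
      (if (foldBits (idMat ι) (zipBits L bs)).2 + (foldBits (idMat ι) (zipBits L (bs.map (! ·)))).2 +
            ((foldBits (foldBits (idMat ι) (zipBits L bs)).1 (trueBits K)).2 +
              (foldBits (foldBits (idMat ι) (zipBits L (bs.map (! ·)))).1 (trueBits K)).2) + 1 = d then
        F 1 (rdPat ix iy is (foldBits (foldBits (idMat ι) (zipBits L bs)).1 (trueBits K)).1)
          (rdPat ix iy is (foldBits (foldBits (idMat ι) (zipBits L (bs.map (! ·)))).1 (trueBits K)).1)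
      else 0)

variable {p : ι → V} {L K : List (ι × ι)} {x y s : V} {ix iy is : ι}

/-- **THE TWO-LEVEL VALUE OF AN EXPLICIT MINOR** (`t = 0` with contracted skeleton edges): `lev2C (plainSet p L) (plainSet p K) x y s F μ`
is `shape0ValK` at the residual level `μ + |L| + 2|K| − 2|V|` (and vanishes below), by `FK.sum_plainListK_empty`. [folklore] -/
theorem lev2C_shape0K (hinj : Function.Injective p) (hx : p ix = x) (hy : p iy = y) (hs : p is = s)
    (hL : ∀ e ∈ L, p e.1 ≠ p e.2) (hnd : (L.map (pedge p)).Nodup) (F : ℕ → Pat3 → Pat3 → ℤ) (μ : ℕ) :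
    lev2C (plainSet p L) (plainSet p K) x y s F μ =
      if 2 * Fintype.card V ≤ μ + L.length + 2 * K.length then
        shape0ValK L K ix iy is F (μ + L.length + 2 * K.length - 2 * Fintype.card V) else 0 := by
  unfold lev2C
  rw [Finset.sum_congr rfl fun γ _ => show
      ((if apExpC (plainSet p L) (plainSet p K) γ = μ then
          F 0 (pat3 (γ ∪ plainSet p K) x y s) (pat3 (plainSet p L \ γ ∪ plainSet p K) x y s) else 0) +
        (if apExpC (plainSet p L) (plainSet p K) γ + 1 = μ then
          F 1 (pat3 (γ ∪ plainSet p K) x y s) (pat3 (plainSet p L \ γ ∪ plainSet p K) x y s) else 0)) =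
      (fun n A B => (if n = μ + 2 * K.length + L.length then F 0 (rdPat ix iy is A) (rdPat ix iy is B) else 0) +
        (if n + 1 = μ + 2 * K.length + L.length then F 1 (rdPat ix iy is A) (rdPat ix iy is B) else 0))
        (apExpC (plainSet p L) (plainSet p K) γ + 2 * K.length + L.length + 0)
        (cmat p (γ ∪ plainSet p K)) (cmat p (plainSet p L \ γ ∪ plainSet p K)) by
    simp only [rdPat, ← pat3_eq_ofBits_cmat p _ hx hy hs]
    rw [ite_eq_ite_of_iff (show apExpC (plainSet p L) (plainSet p K) γ = μ ↔
        apExpC (plainSet p L) (plainSet p K) γ + 2 * K.length + L.length + 0 = μ + 2 * K.length + L.length by omega) rfl,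
      ite_eq_ite_of_iff (show apExpC (plainSet p L) (plainSet p K) γ + 1 = μ ↔
        apExpC (plainSet p L) (plainSet p K) γ + 2 * K.length + L.length + 0 + 1 = μ + 2 * K.length + L.length by omega) rfl],
    sum_plainListK_empty hinj L K hL hnd 0 (fun n A B =>
      (if n = μ + 2 * K.length + L.length then F 0 (rdPat ix iy is A) (rdPat ix iy is B) else 0) +
        (if n + 1 = μ + 2 * K.length + L.length then F 1 (rdPat ix iy is A) (rdPat ix iy is B) else 0))]
  unfold shape0ValK
  split_ifs with h
  · congr 1
    funext bs
    rw [ite_eq_ite_of_iff (show 2 * Fintype.card V + (foldBits (idMat ι) (zipBits L bs)).2 +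
          (foldBits (idMat ι) (zipBits L (bs.map (! ·)))).2 +
          ((foldBits (foldBits (idMat ι) (zipBits L bs)).1 (trueBits K)).2 +
            (foldBits (foldBits (idMat ι) (zipBits L (bs.map (! ·)))).1 (trueBits K)).2) + 0 = μ + 2 * K.length + L.length ↔
        (foldBits (idMat ι) (zipBits L bs)).2 + (foldBits (idMat ι) (zipBits L (bs.map (! ·)))).2 +
          ((foldBits (foldBits (idMat ι) (zipBits L bs)).1 (trueBits K)).2 +
            (foldBits (foldBits (idMat ι) (zipBits L (bs.map (! ·)))).1 (trueBits K)).2) =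
          μ + L.length + 2 * K.length - 2 * Fintype.card V by omega) rfl,
      ite_eq_ite_of_iff (show 2 * Fintype.card V + (foldBits (idMat ι) (zipBits L bs)).2 +
          (foldBits (idMat ι) (zipBits L (bs.map (! ·)))).2 +
          ((foldBits (foldBits (idMat ι) (zipBits L bs)).1 (trueBits K)).2 +
            (foldBits (foldBits (idMat ι) (zipBits L (bs.map (! ·)))).1 (trueBits K)).2) + 0 + 1 = μ + 2 * K.length + L.length ↔
        (foldBits (idMat ι) (zipBits L bs)).2 + (foldBits (idMat ι) (zipBits L (bs.map (! ·)))).2 +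
          ((foldBits (foldBits (idMat ι) (zipBits L bs)).1 (trueBits K)).2 +
            (foldBits (foldBits (idMat ι) (zipBits L (bs.map (! ·)))).1 (trueBits K)).2) + 1 =
          μ + L.length + 2 * K.length - 2 * Fintype.card V by omega) rfl]
  · refine sumBits_eq_zero' L.length fun bs => ?_
    have e1 : ¬ (2 * Fintype.card V + (foldBits (idMat ι) (zipBits L bs)).2 +
        (foldBits (idMat ι) (zipBits L (bs.map (! ·)))).2 +
        ((foldBits (foldBits (idMat ι) (zipBits L bs)).1 (trueBits K)).2 +
          (foldBits (foldBits (idMat ι) (zipBits L (bs.map (! ·)))).1 (trueBits K)).2) + 0 = μ + 2 * K.length + L.length) := by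
      omega
    have e2 : ¬ (2 * Fintype.card V + (foldBits (idMat ι) (zipBits L bs)).2 +
        (foldBits (idMat ι) (zipBits L (bs.map (! ·)))).2 +
        ((foldBits (foldBits (idMat ι) (zipBits L bs)).1 (trueBits K)).2 +
          (foldBits (foldBits (idMat ι) (zipBits L (bs.map (! ·)))).1 (trueBits K)).2) + 0 + 1 =
        μ + 2 * K.length + L.length) := by
      omega
    rw [if_neg e1, if_neg e2, add_zero]

omit [Fintype V] in
/-- The piece-free value with contracted edges vanishes above the structural bound `2|L| + 2|K| + 1`. [folklore] -/
theorem shape0ValK_eq_zero (L K : List (ι × ι)) (ix iy is : ι) (F : ℕ → Pat3 → Pat3 → ℤ) {d : ℕ}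
    (hd : 2 * L.length + 2 * K.length + 1 < d) : shape0ValK L K ix iy is F d = 0 := by
  unfold shape0ValK
  refine sumBits_eq_zero' L.length fun bs => ?_
  have h1 := (foldBits_snd_le (idMat ι) (zipBits L bs)).trans (length_zipBits_le L bs)
  have h2 := (foldBits_snd_le (idMat ι) (zipBits L (bs.map (! ·)))).trans (length_zipBits_le L (bs.map (! ·)))
  have h3 := (foldBits_snd_le (foldBits (idMat ι) (zipBits L bs)).1 (trueBits K)).trans (length_trueBits K).le
  have h4 := (foldBits_snd_le (foldBits (idMat ι) (zipBits L (bs.map (! ·)))).1 (trueBits K)).trans (length_trueBits K).le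
  have e1 : ¬ ((foldBits (idMat ι) (zipBits L bs)).2 + (foldBits (idMat ι) (zipBits L (bs.map (! ·)))).2 +
      ((foldBits (foldBits (idMat ι) (zipBits L bs)).1 (trueBits K)).2 +
        (foldBits (foldBits (idMat ι) (zipBits L (bs.map (! ·)))).1 (trueBits K)).2) = d) := by omega
  have e2 : ¬ ((foldBits (idMat ι) (zipBits L bs)).2 + (foldBits (idMat ι) (zipBits L (bs.map (! ·)))).2 +
      ((foldBits (foldBits (idMat ι) (zipBits L bs)).1 (trueBits K)).2 +
        (foldBits (foldBits (idMat ι) (zipBits L (bs.map (! ·)))).1 (trueBits K)).2) + 1 = d) := by omega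
  rw [if_neg e1, if_neg e2, add_zero]

omit [Fintype V] in
/-- **The exact base check of a piece-free shape with contracted edges**: `F` read on the explicit minor is nonnegative at every
residual level `d ≤ 2|L| + 2|K| + 1` (a `Bool` for `decide`). [folklore] -/
def baseCheck0K (L K : List (ι × ι)) (ix iy is : ι) (F : ℕ → Pat3 → Pat3 → ℤ) : Bool :=
  (List.range (2 * L.length + 2 * K.length + 2)).all fun d => decide (0 ≤ shape0ValK L K ix iy is F d)

/-- **THE EXACT BASE THEOREM WITH CONTRACTED EDGES** (`t = 0`; the bridge row B0 in all `{free, contracted}` states): a passed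
`FK.baseCheck0K` gives `F` levelwise nonnegative at the marks on the explicit minor `(plainSet p L, plainSet p K)`. [folklore] -/
theorem shape0K_nonneg_of_check (hinj : Function.Injective p) (hx : p ix = x) (hy : p iy = y) (hs : p is = s)
    (hL : ∀ e ∈ L, p e.1 ≠ p e.2) (hnd : (L.map (pedge p)).Nodup) {F : ℕ → Pat3 → Pat3 → ℤ}
    (h : baseCheck0K L K ix iy is F = true) (μ : ℕ) : 0 ≤ lev2C (plainSet p L) (plainSet p K) x y s F μ := by
  rw [lev2C_shape0K hinj hx hy hs hL hnd F μ]
  split_ifs with hμ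
  · by_cases hd : μ + L.length + 2 * K.length - 2 * Fintype.card V < 2 * L.length + 2 * K.length + 2
    · unfold baseCheck0K at h
      simp only [List.all_eq_true, decide_eq_true_eq] at h
      exact h _ (List.mem_range.2 hd)
    · rw [shape0ValK_eq_zero L K ix iy is F (by omega)]
  · exact le_rfl

end ShapeZeroK

end FK

end Summit.CriticalPhenomena.PercolationContinuityZ3.Theorems
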